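import Summits.ResolutionOfSingularities.ResolutionOfSingularities.Theorems.WeightedInvariantHypersurfaceLocalGameEFT4SDimLEDoorGradedHom
import Summits.ResolutionOfSingularities.ResolutionOfSingularities.Theorems.WeightedInvariantIota3Tau
import Summits.ResolutionOfSingularities.ResolutionOfSingularities.Theorems.WeightedInvariantContactCylinderStratumLocalizeFlatT
import Summits.ResolutionOfSingularities.ResolutionOfSingularities.Theorems.WeightedInvariantP3tDrop
import Summits.ResolutionOfSingularities.ResolutionOfSingularities.Theorems.WeightedInvariantJOpenPresentationLE3AssemblyNamed
import Summits.ResolutionOfSingularities.ResolutionOfSingularities.Theorems.WeightedInvariantIota3SigmaPresentationOfDominance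
import HarnessLib

/-!
# W4.3 door 19897 — P3-RUNG ASSEMBLY AUDIT for the NAMED PAIR `(ι₃ᵗ, J₃ᵗ) = (Iota3.iotaFlatT, Iota3.jFlatT)`:
# `KeyRungGrHomLE 3 p` from its ELEVEN clauses, with the SIX landed unconditional clauses discharged BY NAME and the FIVE open ones explicit

[OURS · L1 W4.3 · (F-6) of res-L1-w43-plan-1's OFFER 2026-08-27T22:47:04Z; filed by res-L1-type-o4 `--supports stmt-ResolutionOfSingularities-19897 --as helper`]
The registrar's P3 rung `KeyRungGrHomLE 3 p := ∃ ι J, PRungHomLE 3 p ι J ∧ IotaUpperSemicontinuousGradedLE 3 p ι` (…EFT4SDimLEDoorGradedHom; door skeleton v3.12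
`7a4b52ef4f5779aa` PART 5 `stub_keyRungGrHomLE_three`, clause-wise entry `keyRungGrHomLE_three_of_pRungHomLE_and_graded`) for the named pair.
`PRungHomLE 3 p ι J` is the conjunction of TEN door-setting clauses.  THIS FILE is the kernel-checked LEDGER of which of the eleven are in the tree for
`(iotaFlatT, jFlatT)` TONIGHT (2026-08-27T23Z): the theorem `keyRungGrHomLE_three_of_open_clauses` takes exactly the OPEN clauses as hypotheses and discharges
the rest by name — so its hypothesis list IS the gap list (companion prose: `L/res-L1-type-o4/P3-RUNG-GAPS.md`).
DISCHARGED BY NAME (unconditional tree theorems): (c6) `Iota3.iotaFlatT_isoInvariant` (…Iota3Tau) · (c7)≤3 `Iota3.iotaFlatT_generizationMonotoneLE p`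
(…ContactCylinderStratumLocalizeFlatT) · (J-iso) `Iota3.jFlatT_isoInvariant` · (ι-unit) `Iota3.iotaFlatT_unitInvariant` · (J-unit) `Iota3.jFlatT_unitInvariant`
(…P3tDrop) · and (open″)≤3 = h8 REDUCED to its four named inputs by `JOpenLE3.jOpenPresentationForallSingLE_three_of_bodies` (…JOpenPresentationLE3AssemblyNamed).
OPEN (explicit hypotheses below; nearest tree material in the docstring of the theorem): (c8)≤3 upper semicontinuity of ι₃ᵗ · (c10)≤3 torus-factor monotonicity
(tree: `…ContactCylinderTorusFactorFlatT` gives it MODULO three named generic-point hypotheses `h10τ`/`hgenτ`/`hσ`) · (c11)≤3 ess-smooth compatibility of the pair ·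
(c9′-hom)≤3 the game clause (its (pres) sub-block at the `ε ≠ 1` point positions = (σ-pres)₃, which `sigmaPresentationLE3_of_dominance` (p580423) now gives from the
ONE word `TwoFlagDominanceAtLevelLE3Body p`; the (drop) sub-block = `WeightedDropHom`, res-type-060's K-red files) · h8's inputs (T) `TieFreeAlongCurveLE3 p`
(tree: `finite_tiePrimes_over` p559175 + glue) and the point bodies `PointBodyLE3 p 0 0` (p560019, modulo (σ-pres)₃) / `p 0 1` (p562344, modulo (σ-pres)₃) /
`p 1 0` (p558468 ✓) — kept as hypotheses here because their closers' exact binder shapes differ file by file (the audit lists them); the ONE dominance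
word `TwoFlagDominanceAtLevelLE3Body p` enters through (σ-pres)₃ = `sigmaPresentationLE3_of_dominance` (p580423), the (pres) input of those bodies; (c8-gr)≤3 graded upper
semicontinuity (no tree theorem for ι₃ᵗ; F14 falsifier open).  Nothing here is a statement of H. Hironaka's 2017 manuscript; candidates stay candidates;
AI-written, weaker than expert review.  No definition; no new axiom.
-/

noncomputable section

set_option linter.dupNamespace false

open Summit.ResolutionOfSingularities.ResolutionOfSingularities.Theorems
open Summit.ResolutionOfSingularities.ResolutionOfSingularities.Theorems.JOpenLE3

namespace Summit.ResolutionOfSingularities.ResolutionOfSingularities.Cruxes.HypersurfaceCentreConstruction.LocalEngine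

open Iota3

/-- **P3 RUNG FOR THE NAMED PAIR, MODULO EXACTLY ITS OPEN CLAUSES** (assembly audit (F-6)): `KeyRungGrHomLE 3 p` for `(iotaFlatT, jFlatT)` from
(c8)≤3, (c10)≤3, (c11)≤3, (c9′-hom)≤3, the four named inputs of h8 — (T) and the three point bodies — and (c8-gr)≤3; the other five clauses of
`PRungHomLE 3 p` are tree theorems, used by name.  The hypothesis list is the honest GAP LIST of the rung tonight. [OURS · audit glue] -/
theorem keyRungGrHomLE_three_of_open_clauses (p : ℕ)
    (hc8 : IotaUpperSemicontinuousLE 3 p iotaFlatT)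
    (hc10 : IotaTorusFactorMonotoneLE 3 p iotaFlatT)
    (hc11 : IotaJEssSmoothCompatibleLE 3 iotaFlatT jFlatT)
    (hgame : CanonicalGameClauseHomLE 3 p iotaFlatT jFlatT)
    (hT : TieFreeAlongCurveLE3 p) (hP00 : PointBodyLE3 p 0 0) (hP01 : PointBodyLE3 p 0 1) (hP10 : PointBodyLE3 p 1 0)
    (hgr : IotaUpperSemicontinuousGradedLE 3 p iotaFlatT) :
    KeyRungGrHomLE 3 p :=
  ⟨iotaFlatT, jFlatT,
    ⟨⟨iotaFlatT_isoInvariant, iotaFlatT_generizationMonotoneLE p, hc8, hc10, jFlatT_isoInvariant, hc11, hgame,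
      jOpenPresentationForallSingLE_three_of_bodies p hT hP00 hP01 hP10, iotaFlatT_unitInvariant, jFlatT_unitInvariant⟩, hgr⟩⟩

/-- The same in the registrar's `∀ p` shape of `stub_keyRungGrHomLE_three`. [OURS · audit glue] -/
theorem keyRungGrHomLE_three_forall_of_open_clauses
    (hc8 : ∀ p : ℕ, p.Prime → IotaUpperSemicontinuousLE 3 p iotaFlatT)
    (hc10 : ∀ p : ℕ, p.Prime → IotaTorusFactorMonotoneLE 3 p iotaFlatT)
    (hc11 : IotaJEssSmoothCompatibleLE 3 iotaFlatT jFlatT)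
    (hgame : ∀ p : ℕ, p.Prime → CanonicalGameClauseHomLE 3 p iotaFlatT jFlatT)
    (hT : ∀ p : ℕ, p.Prime → TieFreeAlongCurveLE3 p) (hP : ∀ p : ℕ, p.Prime → ∀ e t : Ordinal.{0}, PointBodyLE3 p e t)
    (hgr : ∀ p : ℕ, p.Prime → IotaUpperSemicontinuousGradedLE 3 p iotaFlatT) :
    ∀ p : ℕ, p.Prime → KeyRungGrHomLE 3 p :=
  fun p hp => keyRungGrHomLE_three_of_open_clauses p (hc8 p hp) (hc10 p hp) hc11 (hgame p hp) (hT p hp) (hP p hp 0 0)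
    (hP p hp 0 1) (hP p hp 1 0) (hgr p hp)

end Summit.ResolutionOfSingularities.ResolutionOfSingularities.Cruxes.HypersurfaceCentreConstruction.LocalEngine
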